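import Summits.RiemannHypothesis.RiemannHypothesis.Theorems.OddSectorOddBartaFloorDefs
import Literature.NumberTheory.LFunctions.WeilExplicitArchTermProofs
import Literature.NumberTheory.LFunctions.WeilMarkovQuadratic
import HarnessLib

/-!
# The archimedean term of the truncated odd tail kernel in Bombieri's form
(crux OddBartaFloor, line Sketch, stub tailArchBombieri)

For a window test `g` (`IsWeilTest g`, `tsupport g ⊆ [−a, a]`, `0 < a ≤ b`), the truncated odd
tail `R = R_{a,b} = oddThetaTailTrunc a b = H_b − H_a` (real, bounded, measurable, supported in
`[−b, b]`, and VANISHING on the closed window `[−a, a]`) and the kernel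
`k = g ⋆ R̃ = weilConv g (weilReflect R)`:

  `W_∞(k) = −∫_{r>0} w(r) (k(r) + k(−r)) dr`,   `w = weilArchDensity = e^{r/2}/(2 sinh r)`.

Proof: `k` is a Weil test (a smooth compactly supported function convolved with an integrable
compactly supported one, `HasCompactSupport.contDiff_convolution_left`,
`HasCompactSupport.convolution`), so Bombieri's form of the archimedean term applies
(`weilArchTermBombieri_eq_weilArchTerm_holds`, Bombieri 2000 Thm. 2):
`W_∞(k) = −(log 4π + γ) k(0) − ∫_{r>0} (e^{r/2}(k(r) + k(−r)) − 2k(0))/(2 sinh r) dr`, and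
`k(0) = ∫ g(u) R(u) du = 0` since `g` lives on `[−a, a]` where `R` vanishes. Elementary on top of
the tree's `weilArchTermBombieri_eq_weilArchTerm_holds`. [folklore]
-/

set_option linter.dupNamespace false

noncomputable section

open Set MeasureTheory Filter Complex
open scoped Real Topology ComplexConjugate ArithmeticFunction.vonMangoldt ENNReal

namespace Summit.RiemannHypothesis.RiemannHypothesis.Theorems.OddBartaFloor

open Literature.NumberTheory.LFunctions

/-- The truncated tail vanishes off `[−b, b]` (for `a ≤ b`). [folklore] -/
private theorem stub_tailArchBombieri_zero_off {a b t : ℝ} (hab : a ≤ b) (ht : t ∉ Icc (-b) b) :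
    oddThetaTailTrunc a b t = 0 := by
  rw [oddThetaTailTrunc_def, weilOddThetaVector_of_not_mem ht,
    weilOddThetaVector_of_not_mem fun h => ht (Icc_subset_Icc (neg_le_neg hab) hab h), sub_self]

/-- The truncated tail vanishes on the closed window `[−a, a]` (for `a ≤ b`). [folklore] -/
private theorem stub_tailArchBombieri_zero_on {a b t : ℝ} (hab : a ≤ b) (ht : t ∈ Icc (-a) a) :
    oddThetaTailTrunc a b t = 0 := by
  rw [oddThetaTailTrunc_def, weilOddThetaVector_of_mem (Icc_subset_Icc (neg_le_neg hab) hab ht),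
    weilOddThetaVector_of_mem ht, sub_self]

/-- The reflected complexified tail `R̃(t) = R(−t)` (`R` is real). [folklore] -/
private theorem stub_tailArchBombieri_reflect (a b : ℝ) :
    weilReflect (fun t => ((oddThetaTailTrunc a b t : ℝ) : ℂ)) =
      fun t => ((oddThetaTailTrunc a b (-t) : ℝ) : ℂ) := by
  funext t
  simp only [weilReflect, conj_ofReal]

/-- The kernel `k = g ⋆ R̃` of a Weil test `g` against the truncated tail is a Weil test
(`HasCompactSupport.contDiff_convolution_left`, `HasCompactSupport.convolution`). [folklore] -/
private theorem stub_tailArchBombieri_isWeilTest {a b : ℝ} {g : ℝ → ℂ} (hab : a ≤ b)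
    (hg : IsWeilTest g) :
    IsWeilTest (weilConv g (weilReflect fun t => ((oddThetaTailTrunc a b t : ℝ) : ℂ))) := by
  have hRi : Integrable (oddThetaTailTrunc a b) :=
    (integrable_weilOddThetaVector b).sub (integrable_weilOddThetaVector a)
  have hPi : Integrable (weilReflect fun t => ((oddThetaTailTrunc a b t : ℝ) : ℂ)) := by
    rw [stub_tailArchBombieri_reflect]
    exact (hRi.ofReal (𝕜 := ℂ)).comp_neg
  have hPc : HasCompactSupport (weilReflect fun t => ((oddThetaTailTrunc a b t : ℝ) : ℂ)) := by
    rw [stub_tailArchBombieri_reflect]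
    refine HasCompactSupport.intro isCompact_Icc (K := Icc (-b) b) fun t ht => ?_
    rw [stub_tailArchBombieri_zero_off hab fun h => ht (neg_mem_Icc_neg_iff.1 h), ofReal_zero]
  rw [weilConv_eq_convolution_real]
  exact ⟨hg.2.contDiff_convolution_left (ContinuousLinearMap.mul ℝ ℂ) hg.1 hPi.locallyIntegrable,
    HasCompactSupport.convolution (L := ContinuousLinearMap.mul ℝ ℂ) hg.2 hPc⟩

/-- The kernel vanishes at the origin: `k(0) = ∫ g(u) R(u) du = 0`, as `g` lives on the window
`[−a, a]` where the truncated tail vanishes. [folklore] -/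
private theorem stub_tailArchBombieri_zero {a b : ℝ} {g : ℝ → ℂ} (hab : a ≤ b)
    (hga : tsupport g ⊆ Icc (-a) a) :
    weilConv g (weilReflect fun t => ((oddThetaTailTrunc a b t : ℝ) : ℂ)) 0 = 0 := by
  rw [weilConv_apply, stub_tailArchBombieri_reflect]
  refine integral_eq_zero_of_ae (Eventually.of_forall fun u => ?_)
  simp only [zero_sub, neg_neg, Pi.zero_apply]
  by_cases hu : u ∈ Icc (-a) a
  · rw [stub_tailArchBombieri_zero_on hab hu, ofReal_zero, mul_zero]
  · rw [image_eq_zero_of_notMem_tsupport fun h => hu (hga h), zero_mul]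

/-- **The archimedean term of `k = g ⋆ R̃_{a,b}` in Bombieri's form.** For a window test `g`
(`tsupport g ⊆ [−a, a]`, `0 < a ≤ b`) and the truncated odd tail `R = R_{a,b}`:
`W_∞(g ⋆ R̃) = −∫_{r>0} w(r) (k(r) + k(−r)) dr`, `w = e^{r/2}/(2 sinh r)` (Bombieri's form of the
archimedean term, `weilArchTermBombieri_eq_weilArchTerm_holds`, with `k(0) = 0`). [folklore] -/
theorem stub_tailArchBombieri :
    ∀ (a b : ℝ) (g : ℝ → ℂ), 0 < a → a ≤ b → IsWeilTest g → tsupport g ⊆ Icc (-a) a →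
      weilArchTerm (weilConv g (weilReflect fun t => ((oddThetaTailTrunc a b t : ℝ) : ℂ))) =
        -∫ r in Ioi (0 : ℝ), (weilArchDensity r : ℂ) *
          (weilConv g (weilReflect fun t => ((oddThetaTailTrunc a b t : ℝ) : ℂ)) r +
            weilConv g (weilReflect fun t => ((oddThetaTailTrunc a b t : ℝ) : ℂ)) (-r)) := by
  intro a b g _ hab hg hga
  rw [← weilArchTermBombieri_eq_weilArchTerm_holds (stub_tailArchBombieri_isWeilTest hab hg),
    weilArchTermBombieri_eq, stub_tailArchBombieri_zero hab hga]
  simp only [mul_zero, sub_zero, zero_sub, neg_inj]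
  refine setIntegral_congr_fun measurableSet_Ioi fun r _ => ?_
  simp only [weilArchDensity]
  push_cast
  ring

end Summit.RiemannHypothesis.RiemannHypothesis.Theorems.OddBartaFloor

end
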